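import Mathlib.Analysis.SpecialFunctions.Pow.Real
import Mathlib.Analysis.SpecialFunctions.Log.Basic
import Mathlib.Analysis.SpecialFunctions.Sqrt
import Mathlib.Algebra.Module.ZLattice.Covolume
import Literature.NumberTheory.DiophantineGeometry.Conductor
import Literature.NumberTheory.DiophantineGeometry.LocalReduction
import Literature.NumberTheory.EllipticCurves.GlobalMinimalModel
import Literature.NumberTheory.EllipticCurves.ModularCurve
import HarnessLib

/-!
# Archimedean size of an elliptic curve: covolume of the Néron lattice, `c₄, c₆, Δ`, and the
# modular degree (Silverman 1986; Watkins 2004)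

Topic `NumberTheory/EllipticCurves`; namespace `Literature.NumberTheory.EllipticCurves`.

Named facts (D-0014; `Prop`-valued `def`s, users take `(h : <name>)`) for the archimedean inputs of
the "modular degree ⟹ Szpiro/abc" reductions (Frey; Murty; Pasten §3), in the tree's language:
an elliptic curve over `ℚ` is `W : WeierstrassCurve ℚ` with `[W.IsElliptic]`, a globally minimal
model is `[W.IsGloballyMinimal]`, its Néron lattice is `L.lattice` for a Mathlib `L : PeriodPair`
with `ModularForms.IsNeronLatticeOf (W.baseChange ℂ) L` (the period lattice of
`ω = dx/(2y + a₁x + a₃)`), `covol(Λ) = ZLattice.covolume L.lattice` (Lebesgue measure on `ℂ`) is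
the area of a fundamental parallelogram, a modular parametrisation at level `N` is
`D : ModularForms.ModularParametrizationData W N` with newform `D.f` (`a₁ = 1`), Manin constant
`D.c ∈ ℤ ∖ {0}` and degree `D.modularDegree`, and `(f, f) = ModularForms.peterssonProduct (Γ₀(N)) 2 f f
= ∬_{Γ₀(N)\ℍ} |f|² dx dy` (no volume normalisation; see `ModularDegreeFormula.lean`).

## Sources and the dictionary used

* J. H. Silverman, *Heights and elliptic curves*, Ch. X of Cornell–Silverman, *Arithmetic Geometry*
  (1986), pp. 253–265 (held; read pp. 253–260). Prop. 1.1: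
  `12 [K:ℚ] h(E/K) = log|N Δ_{E/K}| − ∑_{v∣∞} n_v log(|Δ(τ_v)| (Im τ_v)^6)`. Cor. 2.3 (over `ℚ`,
  minimal Weierstrass equation, `Δ, c₄, c₆ ∈ ℤ`): for every `ε > 0`,
  `h(E/ℚ) + O(1) ≤ (1/12) log max{|c₄|³, |c₆|²} ≤ (1 + ε) h(E/ℚ) + O_ε(1)`.
  Eq. (14) (§3, minimal equation, Néron differential `α_E`):
  `h(E/ℚ) = −½ log (i/2) ∫_{E(ℂ)} α_E ∧ ᾱ_E`; and `(i/2) ∫_{E(ℂ)} α_E ∧ ᾱ_E` is the area of a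
  fundamental parallelogram of the period lattice of `α_E` (proof of Prop. 1.1: "the last integral
  is just the area of a fundamental parallelogram"), i.e. `covol(Λ_E)`. Hence
  **`h(E/ℚ) = −½ log covol(Λ_E)`** for a globally minimal model, which is how the facts below
  render Silverman's `h(E/ℚ)` (the tree has no Faltings height yet). The UPPER inequality of
  Cor. 2.3 in this form is already vendored (`ModularForms.silverman1986_discriminant_c4_covolume`,
  `ModularForms.silverman1986_c6_covolume` in `SilvermanHeightCovolume.lean`); consumers take
  those two facts (the printed `max{|c₄|³, |c₆|²}` shape follows with `A = max A₁ A₂`); here we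
  vendor only the LOWER inequality, which is new. Eq. (15)/(18): the Petersson
  norm `‖f‖² = (i/2) ∫_{X₀(N)} f dz ∧ \overline{f dz}` of a normalised (`a₁ = 1`) weight-2 cusp form
  on `Γ₀(N)` satisfies `‖f‖² ≥ e^{−4π}/4π` (integrate over `|x| < 1/2, y > 1`).
* M. Watkins, *Explicit lower bounds on the modular degree of an elliptic curve*,
  arXiv:math/0408126 (2004) (held; read in full). Standing assumption `N ≥ 20000` (§1). `Ω` = "the
  area of the fundamental parallelogram associated to the curve" = real period × imaginary part of
  the imaginary period = `covol(Λ_E)`. Lemma 2.1: `1/Ω ≥ D^{1/6}/14.045`, `D = |Δ|` (the quantity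
  `Ω · |Δ|^{1/6}` is invariant under rescaling the equation, so any model may be used, computing
  `Ω` and `Δ` on the same model). Thm 5.1 (semistable): `deg φ_E ≥ (N/Ω)(0.033/(2 log N)) ≥
  N^{7/6}/(5350 log N)`. Thm 5.2 (all `E/ℚ`): `deg φ_E ≥ … ≥ (N^{7/6}/log N) · (1/10300)/
  √(0.02 + log log N)`. Watkins' `φ` is the modular parametrisation `X₀(N) → E` with integral Manin
  constant `c`, and his bounds use only `c² ≥ 1` in Shimura's identity
  `L(Sym² E, 1)/(2πΩ) = (deg φ / N c²) ∏_{p²∣N} U_p(1)` (§1, §4); every datum `D` of the tree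
  (any `c ∈ ℤ ∖ {0}`) has `deg ≥` the minimal `E`-parametrisation degree, so the bounds hold for
  all `D`. The underlying analytic input is the Goldfeld–Hoffstein–Lieman/Hoffstein–Lockhart
  zero-free region made explicit: `L(Sym² f_E, 1) ≥ 0.033/log N^{(2)}` (Lemma 3.4), not recorded
  here (no symmetric-square `L`-function in the tree).

Deliberately NOT here: Zagier's formula `4π² c² (f,f) = deg · covol` (in the tree, PROVED:
`ModularForms.ModularParametrizationData.zagier_degree_formula_holds`); the folklore
`(f, f) ≫_ε N^{1−ε}` in Petersson form (needs `L(Sym² f, 1)`); Silverman's Prop. 3.4.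

## References

* [Silverman1986] J. H. Silverman, *Heights and elliptic curves*, in: Arithmetic Geometry
  (Cornell, Silverman eds.), Springer 1986, 253–265 — Prop. 1.1, Cor. 2.3, eqs. (14), (15), (18).
* [Watkins2004] M. Watkins, *Explicit lower bounds on the modular degree of an elliptic curve*,
  arXiv:math/0408126 — Lemma 2.1, Thms 5.1, 5.2.
-/

noncomputable section

open Literature.NumberTheory.EllipticCurves.ModularForms CongruenceSubgroup

namespace Literature.NumberTheory.EllipticCurves

/-- **Silverman (1986), Cor. 2.3, lower inequality, in covolume form.** Printed:
`h(E/ℚ) + O(1) ≤ (1/12) log max{|c₄|³, |c₆|²}` (absolute `O(1)`; minimal Weierstrass equation),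
with `h(E/ℚ) = −½ log covol(Λ_E)` by eq. (14). Exponentiating:
`covol(Λ_E)^{−6} ≤ A · max{|c₄|³, |c₆|²}` with an absolute `A > 0`.
[cite: Silverman1986, Cor. 2.3 with eq. (14)] -/
def silverman1986_cor_2_3_lower : Prop :=
  ∃ A : ℝ, 0 < A ∧ ∀ (W : WeierstrassCurve ℚ) [W.IsElliptic] [W.IsGloballyMinimal]
    (L : PeriodPair), IsNeronLatticeOf (W.baseChange ℂ) L →
      ZLattice.covolume L.lattice ^ (-(6 : ℝ)) ≤ A * ((max (|W.c₄| ^ 3) (|W.c₆| ^ 2) : ℚ) : ℝ)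

/-- **Silverman (1986), eq. (18): the trivial lower bound for the Petersson norm.** For the
normalised (`a₁ = 1`) weight-2 newform `f_E` on `Γ₀(N)`:
`‖f_E‖² = (i/2)∫_{X₀(N)} f dz ∧ \overline{f dz} ≥ ∑_{n≥1} |a_n|² e^{−4πn}/(4πn) ≥ e^{−4π}/4π`, since a
fundamental domain for `Γ₀(N)` contains `{|x| < 1/2, y > 1}`. Here `‖f‖²` is the tree's
`peterssonProduct (Γ₀(N)) 2 f f` (real and positive) and `D.f` has `a₁ = a₁(W) = 1`
(`IsNewformOf`). [cite: Silverman1986, §3 eq. (18)] -/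
def silverman1986_eq_18 : Prop :=
  ∀ (N : ℕ) [NeZero N] (W : WeierstrassCurve ℚ) [W.IsElliptic]
    (D : ModularParametrizationData W N),
    Real.exp (-(4 * Real.pi)) / (4 * Real.pi) ≤ (peterssonProduct (Gamma0 N) 2 D.f D.f).re

/-- **Watkins (2004), Lemma 2.1.** "Let `E` be an elliptic curve, `Ω` the area of its fundamental
parallelogram, and `D` the absolute value of its discriminant. Then `1/Ω ≥ D^{1/6}/14.045`."
(Proof via the AGM expressions of the real and imaginary periods; `14.045 > π²/agm(1,1/√2)²`.)
`Ω · D^{1/6}` is unchanged by rescaling the Weierstrass equation (`Δ ↦ u^{−12}Δ`, `Ω ↦ u²Ω`), so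
the statement is recorded for every model `W/ℚ` with `Ω`, `Δ` of that model: `Ω = covol` of the
period lattice of `dx/(2y + a₁x + a₃)` (`IsNeronLatticeOf (W.baseChange ℂ) L`), `D = |W.Δ|`.
[cite: Watkins2004, Lemma 2.1] -/
def watkins2004_lemma_2_1 : Prop :=
  ∀ (W : WeierstrassCurve ℚ) [W.IsElliptic] (L : PeriodPair), IsNeronLatticeOf (W.baseChange ℂ) L →
    ZLattice.covolume L.lattice * ((|W.Δ| : ℚ) : ℝ) ^ (1 / 6 : ℝ) ≤ 14.045

/-- **Watkins (2004), Theorem 5.1** (semistable curves; standing assumption `N ≥ 20000` of §1).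
"Suppose that `E` is a rational semistable elliptic curve. Then
`deg φ_E ≥ (N/Ω) · 0.033/(2 log N) ≥ N^{7/6}/(5350 log N)`", `N` the conductor, `Ω` the area of
the fundamental parallelogram of the Néron lattice (globally minimal model), `φ_E : X₀(N) → E` the
modular parametrisation. Recorded for every parametrisation datum `D` at level `N_E` of a globally
minimal model (its degree is at least that of the minimal parametrisation of `E`, and Watkins'
proof only uses `c² ≥ 1`), as the two lower bounds for `deg`. With Zagier's formula
`deg · Ω = 4π² c² (f, f)` the first is the explicit Goldfeld–Hoffstein–Lieman bound
`c² (f, f) ≥ 0.0165 N/(4π² log N)`. [cite: Watkins2004, Theorem 5.1] -/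
def watkins2004_thm_5_1 : Prop :=
  ∀ (W : WeierstrassCurve ℚ) [W.IsElliptic] [W.IsGloballyMinimal] [NeZero (W.conductorNorm ℤ)],
    W.IsSemistable ℤ → 20000 ≤ W.conductorNorm ℤ →
    ∀ D : ModularParametrizationData W (W.conductorNorm ℤ),
      (W.conductorNorm ℤ : ℝ) / ZLattice.covolume D.L.lattice *
            (0.033 / (2 * Real.log (W.conductorNorm ℤ))) ≤ (D.modularDegree : ℝ) ∧
        (W.conductorNorm ℤ : ℝ) ^ (7 / 6 : ℝ) / (5350 * Real.log (W.conductorNorm ℤ)) ≤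
          (D.modularDegree : ℝ)

/-- **Watkins (2004), Theorem 5.2, last inequality** (all curves; standing assumption
`N ≥ 20000`). "Suppose that `E` is a rational elliptic curve. Then
`deg φ_E ≥ … ≥ (N^{7/6}/log N) · (1/10300)/√(0.02 + log log N)`." (The intermediate bounds involve
the symmetric-square conductor `N^{(2)}` and the factors `U_p(1)` at `p² ∣ N`, not recorded.) The
degree does not depend on the model, so no minimality is assumed. The Lean statement is the
printed one, verbatim.

Provenance (D-0012). The source is an unrefereed arXiv preprint (2004), and its printed proof of
this inequality has two gaps: (i) Lemmas 3.1–3.4 assume `N^{(2)} ≥ 142`, which the standing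
assumption `N ≥ 20000` does not imply (`N^{(2)}` is invariant under quadratic twist: the twists of
`11a` have `N = 11d² ≥ 20000` for `d ≥ 43` and `N^{(2)} = 121`); (ii) the estimate of §4,
`∏_{p²∣N, p≡1(3)} (1 − 1/p) ≥ e^{0.33}/√(0.02 + log log N)` for `N ≥ 20000`, is false — certified
at `N = 24843 = 3·7²·13²` by
`Literature.NumberTheory.EllipticCurves.watkins2004_sec4_primeProduct_bound_counterexample`
(`HeightCovolumeBoundsThm52Proofs.lean`) — so the last "≥" of the display of Theorem 5.2 is not
established as printed (numerically it survives once the local bound `N^{(2)}_p ≤ p²` at the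
additive primes `p ≥ 5` is used, a repair that is not in the source). The inequality is very
plausibly true — it holds on `20000 ≤ N ≤ 28000` from `deg ≥ 1` alone
(`watkins2004_thm_5_2.of_conductorNorm_le`), and ineffectively `deg ≫_ε N^{7/6−ε}` is the
Goldfeld–Hoffstein–Lieman folklore of §1 — but it is recorded here as a CLAIM of the preprint, not
as an established theorem; discharging it needs the explicit symmetric-square theory of §3
(absent from the tree) and a repaired §4. [claim: Watkins2004, status: under-review] -/
def watkins2004_thm_5_2 : Prop :=
  ∀ (W : WeierstrassCurve ℚ) [W.IsElliptic] [NeZero (W.conductorNorm ℤ)],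
    20000 ≤ W.conductorNorm ℤ → ∀ D : ModularParametrizationData W (W.conductorNorm ℤ),
      (W.conductorNorm ℤ : ℝ) ^ (7 / 6 : ℝ) / Real.log (W.conductorNorm ℤ) *
          ((1 / 10300) / Real.sqrt (0.02 + Real.log (Real.log (W.conductorNorm ℤ)))) ≤
        (D.modularDegree : ℝ)

end Literature.NumberTheory.EllipticCurves

end
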